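import Summits.ResolutionOfSingularities.ResolutionOfSingularities.Theorems.PurelyInseparableDim4SpineGame
import Summits.ResolutionOfSingularities.ResolutionOfSingularities.Theorems.PurelyInseparableDim4Perm2BoundOrigin
import Literature.AlgebraicGeometry.Resolution.CentreBlowupMohStability
import HarnessLib
import HarnessLib.Audit.Tags

/-!
# Purely inseparable fourfolds — the ORTHANT ENDGAME of the spine game (cardinality-first wins from orthant positions)

Census cell «res-dim4-pi» (D-0157 DOOR 2), seat res-dim4-p-8 (W3-3 follow-up; question Q-CF∀ / EN-11 of
boards/ROUTES.md WORD #28 (d)).  [OURS · counted 0 · AI kernel work, weaker than expert review.]  Nothing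
here is about resolution of singularities itself; nothing here proves resolution in dimension ≥ 4 /
characteristic `p`.  DEF-FREE (theorems only, in the vocabulary of `PurelyInseparableDim4SpineGame`).

An ORTHANT position of Hironaka's pure polyhedra game is a position `A` containing its componentwise
minimum: some `v ∈ A` with `v ≤ a` for every `a ∈ A` (the Newton polyhedron is the orthant `v + ℝ⁴₊`;
every one-monomial position is one).  The census question Q-CF∀ asks whether SOME tie-breaking of the
cardinality-first rule (the support shadow of the cell's MODE 1h) wins the pure game from every position;
all certified cycles (`SpineCertBatch*`, 460 classes) run through ties.  This file proves the positive
answer ON ORTHANT POSITIONS, for EVERY tie-breaking at once, indeed for every strategy that picks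
INCLUSION-minimal permissible centres:

* §1 along a permissible move the chart image of the vertex is again the componentwise minimum of the
  new position (`pureMove_orthant`), and its total degree satisfies
  `|v'| + q = |v| + Σ_{i ∈ J∖j} vᵢ` (tree: `Perm2Bound.degree_chartExponent_add`), hence DROPS STRICTLY when
  `J` is inclusion-minimal among the permissible centres (`degree_chartExponent_lt_of_minimal`);
* §2 therefore no infinite pure play following an inclusion-minimal strategy starts at an orthant
  position (`not_isPurePlay_of_orthant`), and the same for every CARDINALITY-FIRST strategy (least
  cardinality ⇒ inclusion-minimal: `not_isPurePlay_of_orthant_cardFirst`), in particular from every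
  singleton position;
* §3 consequently every position of an infinite cardinality-first play — e.g. every position of the
  460 certified spine cycles — has at least two incomparable monomials (`not_orthant_of_isPurePlay`).

This is also the elementary «orthant ⇒ Σ < 1» endgame separating Hauser's orthant version of the game
from Hironaka's original winning condition (lit-1 GAME-VERSIONS memo; desk WORD #24 caveat), here for
inclusion-minimal rules.  [cite: Spivakovsky1983, §1 (Hironaka's polyhedra game: permissible sets, the
move, the winning condition Σ xⱼ < 1)]
bears_on: LADDER-RESOLUTION:D157-DOOR2 (res-dim4-pi · W3-3 · Q-CF∀). Supports stmt-ResolutionOfSingularities-16155 (helper).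
-/

-- cell convention (DR-157-C): the summit's doubled path segment is intended, as in the landed Target file
set_option linter.dupNamespace false

namespace Summit.ResolutionOfSingularities.ResolutionOfSingularities.Theorems.PIDim4.SpineOrthant

open Finset
open Literature.AlgebraicGeometry.Resolution
open Literature.AlgebraicGeometry.Resolution.CentreBlowup

/-! ## 1. One move from an orthant position -/

/-- At an orthant position permissibility is read off the vertex: `J` is permissible iff `J ≠ ∅` and
`q ≤ Σ_{i∈J} vᵢ`. [folklore] -/
theorem spinePermissible_iff_vertex {q : ℕ} {J : Finset (Fin 4)} {A : SpinePos} {v : Fin 4 →₀ ℕ}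
    (hv : v ∈ A) (hle : ∀ a ∈ A, v ≤ a) :
    SpinePermissible q J A ↔ J.Nonempty ∧ q ≤ degIn J v := by
  refine ⟨fun h => ⟨h.1, h.2 v hv⟩, fun h => ⟨h.1, fun a ha => ?_⟩⟩
  exact h.2.trans (degIn_le_degIn_of_le J (hle a ha))

/-- The chart law is monotone in the exponent vector. [folklore] -/
theorem chartExponent_le_chartExponent {q : ℕ} {J : Finset (Fin 4)} {j : Fin 4} {v a : Fin 4 →₀ ℕ}
    (h : v ≤ a) : chartExponent q J j v ≤ chartExponent q J j a := by
  refine Finsupp.le_def.mpr fun i => ?_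
  rw [chartExponent_apply, chartExponent_apply]
  split_ifs
  · exact Nat.sub_le_sub_right (degIn_le_degIn_of_le J h) q
  · exact Finsupp.le_def.mp h i

/-- **Orthant positions stay orthant positions**: the chart image of the vertex lies in the new position
and is its componentwise minimum. [folklore] -/
theorem pureMove_orthant {q : ℕ} {J : Finset (Fin 4)} {j : Fin 4} {A : SpinePos} {v : Fin 4 →₀ ℕ}
    (hv : v ∈ A) (hle : ∀ a ∈ A, v ≤ a) :
    chartExponent q J j v ∈ pureMove q J j A ∧
      ∀ a' ∈ pureMove q J j A, chartExponent q J j v ≤ a' := by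
  refine ⟨Finset.mem_image_of_mem _ hv, fun a' ha' => ?_⟩
  obtain ⟨a, ha, rfl⟩ := Finset.mem_image.mp ha'
  exact chartExponent_le_chartExponent (hle a ha)

/-- **The vertex degree drops** under a permissible centre that is inclusion-minimal for the vertex:
`|v'| < |v|` (because `|v'| + q = |v| + Σ_{J∖j} vᵢ` and `Σ_{J∖j} vᵢ < q`). [folklore] -/
theorem degree_chartExponent_lt_of_minimal {q : ℕ} (hq : 0 < q) {J : Finset (Fin 4)} {j : Fin 4}
    (hj : j ∈ J) {v : Fin 4 →₀ ℕ} (hperm : q ≤ degIn J v)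
    (hmin : ∀ J' : Finset (Fin 4), J' ⊂ J → J'.Nonempty → degIn J' v < q) :
    (chartExponent q J j v).degree < v.degree := by
  have hadd := Perm2Bound.degree_chartExponent_add hj hperm
  have herase : degIn (J.erase j) v < q := by
    by_cases hne : (J.erase j).Nonempty
    · exact hmin _ (Finset.erase_ssubset hj) hne
    · rw [Finset.not_nonempty_iff_eq_empty] at hne
      rw [hne, degIn_empty]
      exact hq
  omega

/-! ## 2. No infinite inclusion-minimal / cardinality-first play from an orthant position -/

/-- **No infinite pure play following an INCLUSION-MINIMAL strategy starts at an orthant position**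
(`0 < q`).  The strategy is only required to be permissible and inclusion-minimal at not-yet-won
positions, exactly where `IsPurePlay` consults it. [folklore] -/
theorem not_isPurePlay_of_orthant {q : ℕ} (hq : 0 < q) {σ : SpineStrategy}
    (hσ : ∀ A : SpinePos, ¬ SpineWon q A →
      SpinePermissible q (σ A) A ∧ ∀ J' : Finset (Fin 4), J' ⊂ σ A → ¬ SpinePermissible q J' A)
    {P : ℕ → SpinePos} (hP : IsPurePlay q σ P)
    (horth : ∃ v ∈ P 0, ∀ a ∈ P 0, v ≤ a) : False := by
  -- the vertex at time `k`, with its degree as a strictly decreasing measure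
  suffices key : ∀ (d k : ℕ) (v : Fin 4 →₀ ℕ), v ∈ P k → (∀ a ∈ P k, v ≤ a) → v.degree ≤ d → False by
    obtain ⟨v, hv, hle⟩ := horth
    exact key v.degree 0 v hv hle le_rfl
  intro d
  induction d with
  | zero =>
    intro k v hv hle hd
    -- degree 0 < q: the position is already won, contradicting the play
    exact (hP k).1 (Or.inr ⟨v, hv, lt_of_le_of_lt hd hq⟩)
  | succ d ih =>
    intro k v hv hle hd
    obtain ⟨hnotwon, j, hj, hsucc⟩ := hP k
    obtain ⟨hperm, hmin⟩ := hσ (P k) hnotwon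
    -- the new vertex
    have horth' := pureMove_orthant (q := q) (J := σ (P k)) (j := j) hv hle
    rw [← hsucc] at horth'
    refine ih (k + 1) _ horth'.1 horth'.2 ?_
    have hlt : (chartExponent q (σ (P k)) j v).degree < v.degree := by
      refine degree_chartExponent_lt_of_minimal hq hj (hperm.2 v hv) fun J' hJ' hJ'ne => ?_
      by_contra hge
      exact hmin J' hJ' ((spinePermissible_iff_vertex hv hle).mpr ⟨hJ'ne, Nat.le_of_not_lt hge⟩)
    omega

/-- A CARDINALITY-FIRST choice (least cardinality among the permissible centres) is inclusion-minimal.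
[folklore] -/
theorem not_spinePermissible_of_ssubset_of_cardFirst {q : ℕ} {A : SpinePos} {J J' : Finset (Fin 4)}
    (hmin : ∀ J'' : Finset (Fin 4), SpinePermissible q J'' A → J.card ≤ J''.card) (hJ' : J' ⊂ J) :
    ¬ SpinePermissible q J' A :=
  fun h => Nat.lt_irrefl _ ((Finset.card_lt_card hJ').trans_le (hmin J' h))

/-- **No infinite pure play following a CARDINALITY-FIRST strategy (any tie-breaking) starts at an
orthant position** (`0 < q`): the support shadow of MODE 1h wins Hironaka's pure game from every orthant
position, whatever the ties. [folklore] -/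
theorem not_isPurePlay_of_orthant_cardFirst {q : ℕ} (hq : 0 < q) {σ : SpineStrategy}
    (hσ : ∀ A : SpinePos, ¬ SpineWon q A →
      SpinePermissible q (σ A) A ∧ ∀ J' : Finset (Fin 4), SpinePermissible q J' A → (σ A).card ≤ J'.card)
    {P : ℕ → SpinePos} (hP : IsPurePlay q σ P)
    (horth : ∃ v ∈ P 0, ∀ a ∈ P 0, v ≤ a) : False :=
  not_isPurePlay_of_orthant hq
    (fun A hA => ⟨(hσ A hA).1,
      fun _ hJ' => not_spinePermissible_of_ssubset_of_cardFirst (hσ A hA).2 hJ'⟩) hP horth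

/-- In particular no infinite cardinality-first pure play starts at a ONE-MONOMIAL position. [folklore] -/
theorem not_isPurePlay_of_singleton_cardFirst {q : ℕ} (hq : 0 < q) {σ : SpineStrategy}
    (hσ : ∀ A : SpinePos, ¬ SpineWon q A →
      SpinePermissible q (σ A) A ∧ ∀ J' : Finset (Fin 4), SpinePermissible q J' A → (σ A).card ≤ J'.card)
    {P : ℕ → SpinePos} (hP : IsPurePlay q σ P) (a : Fin 4 →₀ ℕ) (h0 : P 0 = {a}) : False :=
  not_isPurePlay_of_orthant_cardFirst hq hσ hP
    ⟨a, by rw [h0]; exact Finset.mem_singleton_self a,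
      fun b hb => by rw [h0, Finset.mem_singleton] at hb; rw [hb]⟩

/-! ## 3. Positions of infinite cardinality-first plays are never orthant positions -/

/-- A tail of a pure play is a pure play. [folklore] -/
theorem isPurePlay_tail {q : ℕ} {σ : SpineStrategy} {P : ℕ → SpinePos} (hP : IsPurePlay q σ P)
    (k : ℕ) : IsPurePlay q σ fun n => P (k + n) := by
  intro n
  obtain ⟨h1, j, hj, h2⟩ := hP (k + n)
  refine ⟨h1, j, hj, ?_⟩
  show P (k + (n + 1)) = pureMove q (σ (P (k + n))) j (P (k + n))
  rw [← Nat.add_assoc]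
  exact h2

/-- **Every position of an infinite cardinality-first pure play has two incomparable monomials** (it is
not an orthant position; `0 < q`) — in particular every position of the 460 certified spine cycles of
`SpineCertBatch*`. [folklore] -/
theorem not_orthant_of_isPurePlay {q : ℕ} (hq : 0 < q) {σ : SpineStrategy}
    (hσ : ∀ A : SpinePos, ¬ SpineWon q A →
      SpinePermissible q (σ A) A ∧ ∀ J' : Finset (Fin 4), SpinePermissible q J' A → (σ A).card ≤ J'.card)
    {P : ℕ → SpinePos} (hP : IsPurePlay q σ P) (k : ℕ) :
    ¬ ∃ v ∈ P k, ∀ a ∈ P k, v ≤ a := fun horth =>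
  not_isPurePlay_of_orthant_cardFirst hq hσ (isPurePlay_tail hP k) (by simpa using horth)

end Summit.ResolutionOfSingularities.ResolutionOfSingularities.Theorems.PIDim4.SpineOrthant
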